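import Summits.QuantumFields.YangMills.Theorems.AlphaInputsT3ACv3AdaptedSel
import Summits.QuantumFields.YangMills.Theorems.AlphaInputsT3ACv3DataSchema
import HarnessLib

/-!
# `AlphaInputsT3ACv3OfDataSchema` — STRATEGY B for 2′: THE ASSEMBLY `DataSchemaT3AC F 𝔠 a₀ a₁ → AlphaInputsT3AC.OfV3At F 𝔠 a₀ a₁` (design note
# `STRATEGY-B-adapted-class-T3-alpha1-g5.md` §B.0∕B.5 (5)) — lane `pub-balaban3d`, seat alpha-2 (g0)

The v3 (α) package at FIXED constants is CONSTRUCTED from the displayed data schema (`AlphaInputsT3ACv3DataSchema`): composite minimisers `U_k(·, h)` := the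
displayed [7]-minimiser at the trivial history, the measurable argmin selector over the adapted class `𝒞(k, h, W)` (`AlphaInputsT3ACv3AdaptedSel`) elsewhere;
rows r2∕r3∕`hLF67`∕`h68` BY MEMBERSHIP, `hU` by measurability of the selection, `hU0`∕`hUs` by construction, the (α) data rows from the schema.  THEOREMS ONLY.
HONEST YIELD: 2′ = «DISPLAYED cluster-expansion DATA at the AC pieces + [7] Thm 1 (global reading, pinned) + non-emptiness of the adapted class + the window
inequality of the constants» — NODE O's floor in the T³∕AC letters; nothing of the cluster expansion is proved; nothing about d = 4, the continuum, or a mass gap.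

References: T. Bałaban, Commun. Math. Phys. 102 (1985) 255–275 [Balaban1985UV3]; CMP 102 (1985) 277–309 [Balaban1985Variational].
-/

set_option autoImplicit false

noncomputable section

namespace Summit.QuantumFields.YangMills.Theorems

open MeasureTheory Set
open scoped Matrix Matrix.Norms.L2Operator
open Literature.MathematicalPhysics.QuantumFieldTheory.Balaban1983to89
open Literature.MathematicalPhysics.QuantumFieldTheory.Balaban1983to89.B10 (pFun)
open Literature.MathematicalPhysics.QuantumFieldTheory.Balaban1983to89.T3ContinuumYM3Torus
open Literature.MathematicalPhysics.QuantumFieldTheory.Balaban1983to89.T3UnitLawDensityEML (ℰp)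
open Literature.MathematicalPhysics.QuantumFieldTheory.Balaban1983to89.T3UnitScaleTilt (θBal)
open Literature.MathematicalPhysics.QuantumFieldTheory.Balaban1983to89.T3LevelShift (fieldShift)
open Literature.MathematicalPhysics.QuantumFieldTheory.Balaban1983to89.T3PrintedRegularMinimiser (regFibrePr)
open Literature.MathematicalPhysics.QuantumFieldTheory.Balaban1983to89.B10Eq38TorusDomains (plaqsIn)
open Literature.MathematicalPhysics.QuantumFieldTheory.Balaban1983to89.B10Eq42TorusConstraint (bondsIn lam42 lam42_self)
open Literature.MathematicalPhysics.QuantumFieldTheory.Balaban1985CMP102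
open Literature.MathematicalPhysics.QuantumFieldTheory.Balaban1985CMP102.Setting
open Summit.QuantumFields.Balaban3D.Carriers
open Summit.QuantumFields.Balaban3D.Proofs.Primitives
open Summit.QuantumFields.Balaban3D.Proofs.GroupModelLieC (lieC)
open Summit.QuantumFields.Balaban3D.Proofs.LiftBridge (liftCfg)
open Summit.QuantumFields.Balaban3D.Proofs.TowerAC
open Summit.QuantumFields.Balaban3D.Proofs.StandardAC
open Summit.QuantumFields.Balaban3D.Proofs.InputsAC
open Summit.QuantumFields.Balaban3D.Proofs.AlphaAC (AlphaDataAC)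
open Summit.QuantumFields.YangMills.Theorems.AlphaV3AC

/-! ## The construction: `DataSchemaT3AC ⇒ OfV3At` -/

section Construction

variable {F : T3Family} {𝔠 : AlphaConsts F.L (suGroupModel 2).N} {a₀ a₁ : ℝ}

/-- **★ STRATEGY B'S ASSEMBLY: `DataSchemaT3AC F 𝔠 a₀ a₁ → AlphaInputsT3AC.OfV3At F 𝔠 a₀ a₁`.**  Construction (design note §B.2–B.5): regular classes `univ`;
`U_k(·, h) :=` the displayed [7]-minimiser `Ut k` at `h = triv` (so `U_0(·, triv) = id`, `U_k := U_{k+1}(·, triv)` by `rfl`) and, at `h ≠ triv`, the MEASURABLE ARGMIN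
SELECTOR of the Wilson action over the adapted class `𝒞(k, h, W)` (`exists_selector_adaptedClassT3`; `1` beyond `K` or where empty); then `AdaptedToT3` holds, the
displayed data rows supply `𝔖`, `𝔄` with the step data, and: `hU` = measurability of the selection ∕ of `Ut`; r1 = (D5); r2∕r3 at `h ≠ triv` and `hLF67`∕`h68` BY
MEMBERSHIP (non-emptiness (D6)), at `h = triv` r2∕r3 = (D5) for `k ≥ 1`, the window inequality (N1) for `k = 0`, and `hLF67`∕`h68` vacuous (`disc triv = ∅`);
terminal rows = measurability + (D7).  HONEST YIELD: 2′'s ∃-package at FIXED `𝔠` modulo the DISPLAYED schema; nothing of the cluster expansion is proved.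
[cite: Balaban1985UV3, Thm 2 p.272 + (40)–(42) p.266 + (67)–(68) p.273; Balaban1985Variational, Thm 1 (8) p.279] -/
theorem AlphaInputsT3AC.ofV3At_of_dataSchemaT3 (D : DataSchemaT3AC F 𝔠 a₀ a₁) : AlphaInputsT3AC.OfV3At F 𝔠 a₀ a₁ := by
  classical
  intro γ hγ hγ1 K
  obtain ⟨hN1, hne, Ut, hT, hD⟩ := D γ hγ hγ1 K
  obtain ⟨hUt0, hUtm, hr1, hr2t, hr3t⟩ := hT
  -- the measurable argmin selectors, level by level and history by history
  have hsel := fun (k : ℕ) (hk : k ≤ K) (h : Hist (F.P K) k) =>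
    AlphaInputsT3AC.exists_selector_adaptedClassT3 (F := F) (𝔠 := 𝔠) (γ := γ) (hγ := hγ) (hγ1 := hγ1) (K := K) hk h
  let sel : (k : ℕ) → Hist (F.P K) k → GaugeField (F.P K) k (Matrix.specialUnitaryGroup (Fin 2) ℂ) →
      GaugeField (F.P K) 0 (Matrix.specialUnitaryGroup (Fin 2) ℂ) :=
    fun k h => if hk : k ≤ K then Classical.choose (hsel k hk h).1 else fun _ => 1
  let UkH : (k : ℕ) → Hist (F.P K) k → GaugeField (F.P K) k (Matrix.specialUnitaryGroup (Fin 2) ℂ) →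
      GaugeField (F.P K) 0 (Matrix.specialUnitaryGroup (Fin 2) ℂ) :=
    fun k h => if h = Hist.triv (F.P K) k then Ut k else sel k h
  have hpin : ∀ k, UkH k (Hist.triv (F.P K) k) = Ut k := fun k => if_pos rfl
  have hoff : ∀ (k : ℕ) (h : Hist (F.P K) k), h ≠ Hist.triv (F.P K) k → UkH k h = sel k h := fun k h hh => if_neg hh
  have hU0 : ∀ V : GaugeField (F.P K) 0 (Matrix.specialUnitaryGroup (Fin 2) ℂ), UkH 0 (Hist.triv (F.P K) 0) V = V := fun V => by
    rw [hpin]; exact hUt0 V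
  have hmeas : ∀ (k : ℕ) (h : Hist (F.P K) k), Measurable (UkH k h) := by
    intro k h
    by_cases hh : h = Hist.triv (F.P K) k
    · subst hh; rw [hpin]; exact hUtm k
    · rw [hoff k h hh]
      by_cases hk : k ≤ K
      · simp only [sel, dif_pos hk]; exact (Classical.choose_spec (hsel k hk h).1).1
      · simp only [sel, dif_neg hk]; exact measurable_const
  have hmin : ∀ (k : ℕ), k ≤ K → ∀ (h : Hist (F.P K) k), h ≠ Hist.triv (F.P K) k →
      ∀ (W : GaugeField (F.P K) k (Matrix.specialUnitaryGroup (Fin 2) ℂ)), (AlphaInputsT3AC.adaptedClassT3 F 𝔠 γ hγ hγ1 K k h W).Nonempty →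
        UkH k h W ∈ AlphaInputsT3AC.adaptedClassT3 F 𝔠 γ hγ hγ1 K k h W ∧
          IsMinOn (fun U : GaugeField (F.P K) 0 (Matrix.specialUnitaryGroup (Fin 2) ℂ) => wilsonAction4 U)
            (AlphaInputsT3AC.adaptedClassT3 F 𝔠 γ hγ hγ1 K k h W) (UkH k h W) := by
    intro k hk h hh W hW
    rw [hoff k h hh]
    simp only [sel, dif_pos hk]
    exact (Classical.choose_spec (hsel k hk h).1).2.1 W ((hsel k hk h).2 W hW)
  have hAd : AlphaInputsT3AC.AdaptedToT3 F 𝔠 γ hγ hγ1 K Ut UkH := ⟨hpin, hmeas, hmin⟩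
  obtain ⟨𝔖, 𝔄, hsteps, hPm, hPb⟩ := hD UkH hU0 hAd
  -- membership at non-trivial admissible histories
  have hmem : ∀ (k : ℕ), k ≤ K → ∀ (h : Hist (F.P K) k),
      Hist.Admissible 𝔠.lane.carrier.M₁ (rcolOf (T3Scales F γ hγ (hγ1.trans (sq_min_one_le _ 𝔠.gamma0_pos)) K) 𝔠.lane.carrier) k h →
      h ≠ Hist.triv (F.P K) k → ∀ (W : GaugeField (F.P K) k (Matrix.specialUnitaryGroup (Fin 2) ℂ)),
        UkH k h W ∈ AlphaInputsT3AC.adaptedClassT3 F 𝔠 γ hγ hγ1 K k h W :=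
    fun k hk h hh ht W => (hmin k hk h ht W (hne k hk h hh ht W)).1
  refine ⟨fun _ => Set.univ, fun k => UkH (k + 1) (Hist.triv (F.P K) (k + 1)), UkH, hU0, fun _ _ => rfl, 𝔖, 𝔄, ?_, ⟨?_, ?_, ?_⟩, ?_⟩
  · -- the v3 (α) rows: steps = DATA + hU; (67)/(68) by membership (vacuous at the trivial history)
    refine ⟨fun k hk => (hsteps k hk).toStepAlpha (fun h => hmeas k h), fun k hk h hh U => ?_, fun k hk h hh U => ?_⟩
    · by_cases ht : h = Hist.triv (F.P K) k
      · intro e he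
        have he' : e ∈ Hist.disc (P := F.P K) (Hist.triv (F.P K) k) := ht ▸ he
        rw [Hist.disc_triv] at he'
        exact absurd he' (Finset.notMem_empty e)
      · exact AlphaInputsT3AC.hLF67_of_mem_adaptedClassT3 (hmem k hk h hh ht U)
    · by_cases ht : h = Hist.triv (F.P K) k
      · intro e he
        have he' : e ∈ Hist.disc (P := F.P K) (Hist.triv (F.P K) k) := ht ▸ he
        rw [Hist.disc_triv] at he'
        exact absurd he' (Finset.notMem_empty e)
      · exact AlphaInputsT3AC.h68_of_mem_adaptedClassT3 hk hh (hmem k hk h hh ht U)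
  · -- r1: the displayed [7] Thm 1 rows of `Ut`, pinned
    intro n hnK ε₁ ε₀ h1 h2 h3 h4 V hV
    rw [hpin]
    exact hr1 n hnK ε₁ ε₀ h1 h2 h3 h4 V hV
  · -- r2
    intro k hk h W hc b hb
    by_cases ht : h = Hist.triv (F.P K) k
    · subst ht
      rw [hpin]
      rcases Nat.eq_zero_or_pos k with rfl | hk0
      · show Ut 0 W b = W b
        rw [hUt0]
      · exact hr2t k hk0 hk W hc b hb
    · exact AlphaInputsT3AC.constraint42_of_mem_adaptedClassT3 (hmem k hk h hc.1 ht W) hc b hb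
  · -- r3
    intro k hk h W hc i hi s hs q hq
    by_cases ht : h = Hist.triv (F.P K) k
    · subst ht
      rw [hpin]
      rcases Nat.eq_zero_or_pos k with rfl | hk0
      · obtain rfl : i = 0 := Nat.le_zero.mp hi
        obtain rfl : s = 0 := Nat.le_zero.mp hs
        rw [lam42_self] at hq
        have hlt := hc.2 q (Finset.mem_coe.mpr hq)
        have h1 : (((F.L : ℝ) ^ (0 - 0))⁻¹) ^ 2 = 1 := by simp
        rw [h1, mul_one, Nat.sub_zero]
        show GaugeGroup.dist1 (GaugeField.plaqHol (Ut 0 W) q) ≤ _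
        rw [hUt0]
        have hK1 : K - 0 + 1 = K + 1 := by simp
        rw [hK1] at hlt
        exact (hlt.le).trans hN1
      · exact hr3t k hk0 hk W hc i hi s hs q hq
    · exact AlphaInputsT3AC.regularity68Levels_of_mem_adaptedClassT3 (hmem k hk h hc.1 ht W) hc i hi s hs q hq
  · -- terminal rows
    exact ⟨fun h => hmeas K h, hPm, hPb⟩

end Construction

end Summit.QuantumFields.YangMills.Theorems

end
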